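import Summits.Schanuel.Schanuel.Theorems.SoloInformedX193Pieces

/-!
# X193 kernel line, file F9a: the pieces of an enemy sequence are well formed (layer B)

Solo seat `solo-Schanuel-informed`, X193 kernel programme (design note
`work/s213/X193-KERNEL-DESIGN.md`, Amendment A12 (iii); pen proof `work/s194/X193-pen.md` §1;
file F2 = `SoloInformedX193Service` (the law `SoloServiceData.wellFormed`), file F8 =
`SoloInformedX193Pieces` (the concrete structure `soloX_pieces ξ R` and the three local
conjuncts of the law)).

The law `wellFormed c₀` asks: degrees `≥ 1`, log-heights `≥ 0`, `alive ↔ 1 ≤ mult` (F8),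
and two facts about NEAR-ROOT columns (a column `k` is near-root for the piece `P` when some
complex root of `P` lies within `‖ξ‖/2` of `kξ`):

* (NRb) at a column that is NOT near-root the bank is small: every root `α` of `P` has
  `‖kξ - α‖ ≥ ‖ξ‖/2`, so `‖P(kξ)‖ = |a_g| ∏_α ‖kξ - α‖ ≥ (‖ξ‖/2)^g` and
  `bank = -log ‖P(kξ)‖ ≤ g (log 2 - log ‖ξ‖) ≤ c₀ g` with `c₀ = max 0 (log 2 - log ‖ξ‖)`;
* (NRc) a piece of degree `g` is near-root at no more than `g` columns: distinct columns
  `k ≠ k'` are `‖kξ - k'ξ‖ ≥ ‖ξ‖` apart, so a root within `‖ξ‖/2` of `kξ` is not within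
  `‖ξ‖/2` of `k'ξ`; choosing such a root for each near-root column injects the columns into
  the (at most `g`) complex roots.

Hence `soloX_pieces ξ R ∈ wellFormed (max 0 (log 2 - log ‖ξ‖))` for every `ξ ≠ 0` and
every sequence `R` (`soloX_pieces_wellFormed`).  On the way: the factorisation of the value
`‖P(z)‖ = ‖a_g‖ · ‖∏_α (z - α)‖` over `ℂ` (`soloX_norm_aeval_eq`) and the product lower
bound (`soloX_pow_card_le_norm_prod`), reused by the service law (file F9b).  No sorries.
-/

namespace Summit.Schanuel.Schanuel.Theorems

open Polynomial

/-! ### Values of integer polynomials through their complex roots -/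

/-- If every element of `s` is at distance `≥ r ≥ 0` from `z`, then
`r ^ |s| ≤ ‖∏_{a ∈ s} (z - a)‖`. -/
theorem soloX_pow_card_le_norm_prod (z : ℂ) {r : ℝ} (hr : 0 ≤ r) (s : Multiset ℂ)
    (h : ∀ a ∈ s, r ≤ ‖z - a‖) :
    r ^ Multiset.card s ≤ ‖(s.map fun a => z - a).prod‖ := by
  induction s using Multiset.induction_on with
  | empty => simp
  | cons a s ih =>
    rw [Multiset.map_cons, Multiset.prod_cons, norm_mul, Multiset.card_cons, pow_succ']
    exact mul_le_mul (h a (Multiset.mem_cons_self a s))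
      (ih fun b hb => h b (Multiset.mem_cons_of_mem hb)) (pow_nonneg hr _) (norm_nonneg _)

/-- The complex roots of an integer polynomial, with multiplicity, number exactly its
degree (`ℂ` is algebraically closed and `ℤ → ℂ` is injective). -/
theorem soloX_card_aroots_eq (p : ℤ[X]) : Multiset.card (p.aroots ℂ) = p.natDegree := by
  have h1 : Multiset.card (p.map (algebraMap ℤ ℂ)).roots = (p.map (algebraMap ℤ ℂ)).natDegree :=
    splits_iff_card_roots.mp (IsAlgClosed.splits _)
  rw [natDegree_map_eq_of_injective (algebraMap ℤ ℂ).injective_int] at h1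
  exact h1

/-- The value of an integer polynomial at a complex point through its roots:
`‖P(z)‖ = ‖a_g‖ · ‖∏_α (z - α)‖` (`a_g` the leading coefficient, `α` over the complex
roots with multiplicity). -/
theorem soloX_norm_aeval_eq (p : ℤ[X]) (z : ℂ) :
    ‖aeval z p‖ =
      ‖(p.leadingCoeff : ℂ)‖ * ‖((p.aroots ℂ).map fun a => z - a).prod‖ := by
  set pc : ℂ[X] := p.map (algebraMap ℤ ℂ) with hpc
  have hsplit : Multiset.card pc.roots = pc.natDegree :=
    splits_iff_card_roots.mp (IsAlgClosed.splits pc)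
  have hprod := C_leadingCoeff_mul_prod_multiset_X_sub_C hsplit
  have hlc : pc.leadingCoeff = (p.leadingCoeff : ℂ) := by
    rw [hpc, leadingCoeff_map_of_injective (algebraMap ℤ ℂ).injective_int]
    simp
  have heval : aeval z p = pc.eval z := by rw [aeval_def, hpc, eval_map]
  have heval' : aeval z p =
      (C pc.leadingCoeff * (pc.roots.map fun a => X - C a).prod).eval z := by
    rw [hprod]; exact heval
  have hroots : p.aroots ℂ = pc.roots := rfl
  have hfun : (eval z ∘ fun a : ℂ => X - C a) = fun a => z - a := by
    funext a
    simp
  rw [heval', hroots, eval_mul, eval_C, eval_multiset_prod, Multiset.map_map, norm_mul, hlc,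
    hfun]

/-- The leading coefficient of a piece has complex norm `≥ 1`. -/
theorem soloX_piece_one_le_norm_leadingCoeff (P : soloX_pieceSet) :
    1 ≤ ‖((P : ℤ[X]).leadingCoeff : ℂ)‖ := by
  rw [Complex.norm_intCast]
  exact_mod_cast Int.one_le_abs (soloX_piece_leadingCoeff_ne_zero P)

/-- Root-distance lower bound for a piece: if every complex root of `P` is at distance
`≥ r ≥ 0` from `z`, then `r ^ deg P ≤ ‖P(z)‖`. -/
theorem soloX_piece_pow_le_norm_aeval (P : soloX_pieceSet) (z : ℂ) {r : ℝ} (hr : 0 ≤ r)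
    (h : ∀ α ∈ (P : ℤ[X]).aroots ℂ, r ≤ ‖z - α‖) :
    r ^ (P : ℤ[X]).natDegree ≤ ‖aeval z (P : ℤ[X])‖ := by
  rw [soloX_norm_aeval_eq, ← soloX_card_aroots_eq]
  have h1 := soloX_pow_card_le_norm_prod z hr _ h
  have h2 := soloX_piece_one_le_norm_leadingCoeff P
  calc r ^ Multiset.card ((P : ℤ[X]).aroots ℂ)
      = 1 * r ^ Multiset.card ((P : ℤ[X]).aroots ℂ) := (one_mul _).symm
    _ ≤ ‖((P : ℤ[X]).leadingCoeff : ℂ)‖ *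
          ‖(((P : ℤ[X]).aroots ℂ).map fun a => z - a).prod‖ :=
        mul_le_mul h2 h1 (pow_nonneg hr _) (le_trans zero_le_one h2)

/-! ### (NRb) banks at non-near-root columns -/

/-- (NRb) For `ξ ≠ 0`: at a column `k` that is not near-root for the piece `P`, the bank
is small, `-log ‖P(kξ)‖ ≤ max 0 (log 2 - log ‖ξ‖) · deg P`. -/
theorem soloX_pieces_bank_le_of_nearRoot_false {ξ : ℂ} (hξ : ξ ≠ 0) (R : ℕ → ℤ[X])
    (P : soloX_pieceSet) (k : ℕ) (h : (soloX_pieces ξ R).nearRoot P k = false) :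
    (soloX_pieces ξ R).bank P k ≤
      max 0 (Real.log 2 - Real.log ‖ξ‖) * (soloX_pieces ξ R).deg P := by
  rw [soloX_pieces_nearRoot_eq_false_iff] at h
  rw [soloX_pieces_bank, soloX_pieces_deg]
  have hξ' : 0 < ‖ξ‖ := norm_pos_iff.mpr hξ
  have hr : 0 < ‖ξ‖ / 2 := by positivity
  have hval : (‖ξ‖ / 2) ^ (P : ℤ[X]).natDegree ≤ ‖aeval ((k : ℂ) * ξ) (P : ℤ[X])‖ :=
    soloX_piece_pow_le_norm_aeval P _ hr.le h
  have hpow : 0 < (‖ξ‖ / 2) ^ (P : ℤ[X]).natDegree := pow_pos hr _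
  have hlog := Real.log_le_log hpow hval
  rw [Real.log_pow, Real.log_div hξ'.ne' two_ne_zero] at hlog
  have hg : (0 : ℝ) ≤ (P : ℤ[X]).natDegree := Nat.cast_nonneg _
  have hmax : Real.log 2 - Real.log ‖ξ‖ ≤ max 0 (Real.log 2 - Real.log ‖ξ‖) :=
    le_max_right _ _
  nlinarith [mul_le_mul_of_nonneg_left hmax hg]

/-! ### (NRc) the number of near-root columns -/

/-- Distinct columns are `‖ξ‖` apart: `‖kξ - k'ξ‖ ≥ ‖ξ‖` for naturals `k ≠ k'`. -/
theorem soloX_norm_sub_col_ge (ξ : ℂ) {k k' : ℕ} (hne : k ≠ k') :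
    ‖ξ‖ ≤ ‖(k : ℂ) * ξ - (k' : ℂ) * ξ‖ := by
  rw [← sub_mul, norm_mul]
  have hm : (k : ℤ) - k' ≠ 0 := by omega
  have h1 : (1 : ℝ) ≤ ‖(k : ℂ) - (k' : ℂ)‖ := by
    have : ((k : ℂ) - (k' : ℂ)) = (((k : ℤ) - (k' : ℤ) : ℤ) : ℂ) := by push_cast; ring
    rw [this, Complex.norm_intCast]
    exact_mod_cast Int.one_le_abs hm
  calc ‖ξ‖ = 1 * ‖ξ‖ := (one_mul _).symm
    _ ≤ ‖(k : ℂ) - (k' : ℂ)‖ * ‖ξ‖ := mul_le_mul_of_nonneg_right h1 (norm_nonneg _)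

/-- A complex number within `‖ξ‖/2` of two columns `kξ`, `k'ξ` forces `k = k'`. -/
theorem soloX_col_eq_of_near (ξ : ℂ) {k k' : ℕ} {α : ℂ}
    (h1 : ‖(k : ℂ) * ξ - α‖ < ‖ξ‖ / 2) (h2 : ‖(k' : ℂ) * ξ - α‖ < ‖ξ‖ / 2) : k = k' := by
  by_contra hne
  have htri : ‖(k : ℂ) * ξ - (k' : ℂ) * ξ‖ < ‖ξ‖ := by
    calc ‖(k : ℂ) * ξ - (k' : ℂ) * ξ‖
        ≤ ‖(k : ℂ) * ξ - α‖ + ‖α - (k' : ℂ) * ξ‖ := norm_sub_le_norm_sub_add_norm_sub _ _ _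
      _ < ‖ξ‖ / 2 + ‖ξ‖ / 2 := by rw [norm_sub_rev α]; exact add_lt_add h1 h2
      _ = ‖ξ‖ := by ring
  have hlow := soloX_norm_sub_col_ge ξ hne
  linarith

/-- (NRc) For `ξ ≠ 0`: a piece is near-root at no more than `deg P` columns (any finite set
of near-root columns injects into the complex roots). -/
theorem soloX_pieces_card_nearRoot_le {ξ : ℂ} (R : ℕ → ℤ[X]) (P : soloX_pieceSet)
    (S : Finset ℕ) (hS : ∀ k ∈ S, (soloX_pieces ξ R).nearRoot P k = true) :
    S.card ≤ (soloX_pieces ξ R).deg P := by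
  classical
  rw [soloX_pieces_deg]
  have hS' : ∀ k ∈ S, ∃ α ∈ (P : ℤ[X]).aroots ℂ, ‖(k : ℂ) * ξ - α‖ < ‖ξ‖ / 2 :=
    fun k hk => (soloX_pieces_nearRoot_iff ξ R P k).mp (hS k hk)
  choose! f hf using hS'
  have hmaps : Set.MapsTo f (S : Set ℕ) (((P : ℤ[X]).aroots ℂ).toFinset : Set ℂ) :=
    fun k hk => Finset.mem_coe.mpr (Multiset.mem_toFinset.mpr (hf k hk).1)
  have hinj : Set.InjOn f (S : Set ℕ) := by
    intro k hk k' hk' hkk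
    have h1 := (hf k hk).2
    have h2 := (hf k' hk').2
    rw [hkk] at h1
    exact soloX_col_eq_of_near ξ h1 h2
  calc S.card ≤ ((P : ℤ[X]).aroots ℂ).toFinset.card := Finset.card_le_card_of_injOn f hmaps hinj
    _ ≤ Multiset.card ((P : ℤ[X]).aroots ℂ) := Multiset.toFinset_card_le _
    _ = (P : ℤ[X]).natDegree := soloX_card_aroots_eq _

/-! ### The law -/

/-- The constant `c₀(ξ) = max 0 (log 2 - log ‖ξ‖)` is non-negative. -/
theorem soloX_c₀_nonneg (ξ : ℂ) : 0 ≤ max 0 (Real.log 2 - Real.log ‖ξ‖) := le_max_left _ _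

/-- **(WF) for the pieces of an enemy sequence.**  For `ξ ≠ 0` and any sequence `R`, the
structure `soloX_pieces ξ R` is well formed with the constant
`c₀ = max 0 (log 2 - log ‖ξ‖)`: degrees `≥ 1`, log-heights `≥ 0`, `alive ↔ 1 ≤ mult`,
(NRb) and (NRc). -/
theorem soloX_pieces_wellFormed {ξ : ℂ} (hξ : ξ ≠ 0) (R : ℕ → ℤ[X]) :
    soloX_pieces ξ R ∈ SoloServiceData.wellFormed (max 0 (Real.log 2 - Real.log ‖ξ‖)) :=
  ⟨soloX_pieces_one_le_deg ξ R, soloX_pieces_logHt_nonneg ξ R,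
    soloX_pieces_alive_iff_mult ξ R,
    fun P k h => soloX_pieces_bank_le_of_nearRoot_false hξ R P k h,
    fun P S hS => soloX_pieces_card_nearRoot_le R P S hS⟩

/-- Consumer form: for `ξ ≠ 0` there is a constant `c₀ ≥ 0` with
`soloX_pieces ξ R ∈ wellFormed c₀`. -/
theorem soloX_pieces_exists_wellFormed {ξ : ℂ} (hξ : ξ ≠ 0) (R : ℕ → ℤ[X]) :
    ∃ c₀ : ℝ, 0 ≤ c₀ ∧ soloX_pieces ξ R ∈ SoloServiceData.wellFormed c₀ :=
  ⟨_, soloX_c₀_nonneg ξ, soloX_pieces_wellFormed hξ R⟩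

end Summit.Schanuel.Schanuel.Theorems
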